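import Literature.IUT.HodgeArakelov.BadPlaceSettingOfUnderline

/-!
# [IUTchII] Def 2.3 (i) at the [EtTh] model, geometric side: `[Δ^tp_{X_v} : Δ^tp_{X̲_v}] = l`, `[Δ^tp_{X̲_v} : Δ^tp_{X̲̲_v}] = l`

S. Mochizuki, *Inter-universal Teichmüller theory II*, kurims manuscript (Dec. 2020), §2, Def. 2.3 (i), p. 67: "`Δ_v := Δ^tp_{X̲̲_v}`,
`Δ^±_v := Δ^tp_{X̲_v}` … we recall that `Δ̂_v` includes as a normal open subgroup of `Δ̂^±_v` of index `l` [cf. [EtTh], Proposition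
2.2, (ii)]" ([IUTchII] Def 2.3 (i), kurims p.67) [claim: Mochizuki2012, status: disputed] (D-0012 claim key; series status
DISPUTED — elementary index computations over abc-iut-L2's [EtTh] data only; nothing of the series is asserted); [EtTh] Prop. 2.2
(ii) p. 37, Rmk. 2.3.1 p. 38 [cite: MochizukiEtTh2009, Prop 2.2 (ii) p.37].  PROOF-ONLY sequel (abc-iut cell, seat
abc-iut-L6-t19 gen 5) of `BadPlaceSettingOfUnderline.lean` (the print-level model, `Π^tp_{X_v} := Π^tp_{X̲_v} = D.GtpXu l`,
finding F-L6t19g5-1); no definitions; nothing landed is edited.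

abc-iut-L2 has the Π-level indices at the model — `[Π^tp_X : Π^tp_X̲] = l` (abc-iut-L2-t7 `ThetaSetting.index_GtpXu`),
`[Π^tp_X̲ : Π^tp_X̲̲] = l` (`DoubleUnderline.relIndex_Huu_GtpXu`) — and the geometric connectedness facts `Δ^tp_X · Π^tp_X̲ = Π^tp_X`
(`deltaTemp_sup_GtpXu`), `Im(Π^tp_X̲̲ → G_K) = G_K` (`DoubleUnderline.map_aug_Huu`).  THIS FILE derives the GEOMETRIC (Δ-level,
tempered) indices that abc-iut-L6-t1's `PlusMinusTower.deltaHat_index` ("`[Δ̂^±_v : Δ̂_v] = l`") quotes, by the index form of the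
second isomorphism theorem (abc-iut-L2-t2's `ThetaCovers.CoverData.relIndex_sup_eq_relIndex_of_normal`, `[A·N : A] = [N : A ∩ N]`
for `N` normal):

* `ThetaSetting.relIndex_GtpXu_deltaTemp` — `[Δ^tp_X : Δ^tp_X ∩ Π^tp_X̲] = l` (`N := Δ^tp_X`);
* **`DoubleUnderline.relIndex_Huu_deltaTemp_inf_GtpXu`** — `[Δ^tp_{X̲} : Δ^tp_{X̲} ∩ Π^tp_X̲̲] = l`, i.e. print's
  `[Δ^±_v : Δ_v] = l` at the tempered level of the model (`N := Δ^tp_X ∩ Π^tp_X̲`, normal in `Π^tp_X`; `Π^tp_X̲̲ · N = Π^tp_X̲`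
  because `Π^tp_X̲̲ ↠ G_K`);
* `DoubleUnderline.relIndex_Huu_deltaTemp` — `[Δ^tp_X : Δ^tp_X ∩ Π^tp_X̲̲] = l²` ("two copies of `ℤ/lℤ`", [EtTh] Rmk. 2.3.1).

NOT here: the third printed index `[Δ̂^cor_v : Δ̂^±_v] = 2l` (needs `Π^tp_{C_v}`, abc-iut-L2's `ThetaCovers` side — NV-BLOCKED per
abc-iut-L6-lead §F v1.19b (2)), normality of `Π^tp_X̲̲` in `Π^tp_X̲` (asked of the abc-iut-L2-t8 lineage 03:48Z), profinite
completions.  Nothing here takes a side on [IUTchIII] Cor. 3.12; typed ≠ proved.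
-/

noncomputable section

namespace Literature.AnabelianGeometry.EtaleTheta

namespace ThetaSetting

variable {p : ℕ} [Fact p.Prime] (D : ThetaSetting p) (l : ℕ)

/-- `Δ^tp_X = Ker(Π^tp_X → G_{ℚ_p})` is normal in `Π^tp_X` (cf. `Thm16Sub.deltaTemp_normal`; private copy to keep imports light).
[cite: MochizukiEtTh2009, §1 p.12] -/
private theorem deltaTemp_normal : D.DeltaTemp.Normal := by
  change D.aug.toMonoidHom.ker.Normal
  infer_instance

/-- **`[Δ^tp_X : Δ^tp_X ∩ Π^tp_X̲] = l`** at the [EtTh] §1 model (`Π^tp_X̲ = toZ⁻¹(l·ℤ)`): from `Δ^tp_X · Π^tp_X̲ = Π^tp_X`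
(abc-iut-L2-t7's `deltaTemp_sup_GtpXu`, "the restricted map `Δ̄^ell_X → Q` is still surjective", [EtTh] Def. 2.1) and
`[Π^tp_X : Π^tp_X̲] = l` (`index_GtpXu`) by `[A·N : A] = [N : A ∩ N]`.  PROVED. [cite: MochizukiEtTh2009, Def 2.1 p.36] -/
theorem relIndex_GtpXu_deltaTemp : (D.GtpXu l).relIndex D.DeltaTemp = l := by
  haveI := D.deltaTemp_normal
  rw [← ThetaCovers.CoverData.relIndex_sup_eq_relIndex_of_normal (D.GtpXu l) D.DeltaTemp, sup_comm,
    D.deltaTemp_sup_GtpXu l, Subgroup.relIndex_top_right]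
  exact D.index_GtpXu l

variable {D l} {E : D.EtaleThetaData} (C : E.DoubleUnderline l)

/-- `Π^tp_X̲̲ · (Δ^tp_X ∩ Π^tp_X̲) = Π^tp_X̲`: every element of `Π^tp_X̲` differs from an element of `Π^tp_X̲̲` by a geometric element
(since `Π^tp_X̲̲ ↠ G_K`, abc-iut-L2-t8's `map_aug_Huu`, [EtTh] Prop. 2.2 (iii) "`G_K ≅ Π_X̲̲/Δ_X̲̲`").  PROVED.
[cite: MochizukiEtTh2009, Prop 2.2 (iii) p.37] -/
theorem EtaleThetaData.DoubleUnderline.Huu_sup_deltaTemp_inf_GtpXu :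
    C.Huu ⊔ (D.DeltaTemp ⊓ D.GtpXu l) = D.GtpXu l := by
  refine le_antisymm (sup_le C.Huu_le_GtpXu inf_le_right) ?_
  intro g hg
  have haug : D.aug.toMonoidHom g ∈ C.Huu.map D.aug.toMonoidHom := by
    rw [C.map_aug_Huu]
    exact D.aug_mem_GK g
  obtain ⟨h, hh, hhg⟩ := haug
  have hker : h⁻¹ * g ∈ D.DeltaTemp := by
    change h⁻¹ * g ∈ D.aug.toMonoidHom.ker
    rw [MonoidHom.mem_ker, map_mul, map_inv, hhg, inv_mul_cancel]
  have hXu : h⁻¹ * g ∈ D.GtpXu l := (D.GtpXu l).mul_mem ((D.GtpXu l).inv_mem (C.Huu_le_GtpXu hh)) hg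
  have : g = h * (h⁻¹ * g) := by group
  rw [this]
  exact Subgroup.mul_mem_sup hh (Subgroup.mem_inf.mpr ⟨hker, hXu⟩)

/-- **`[Δ^tp_{X̲_v} : Δ^tp_{X̲̲_v}] = l` at the [EtTh] model** — print's "`Δ̂_v` … normal open subgroup of `Δ̂^±_v` of index `l`"
([IUTchII] Def. 2.3 (i); [EtTh] Prop. 2.2 (ii)) at the tempered level, with `Δ^tp_{X̲} := Δ^tp_X ∩ Π^tp_X̲` and
`Δ^tp_{X̲̲} := Δ^tp_X ∩ Π^tp_X̲̲`: from `[Π^tp_X̲ : Π^tp_X̲̲] = l` (abc-iut-L2-t7's `relIndex_Huu_GtpXu`) and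
`Π^tp_X̲̲ · Δ^tp_{X̲} = Π^tp_X̲` by `[A·N : A] = [N : A ∩ N]` (`N := Δ^tp_{X̲}`, normal in `Π^tp_X`).  PROVED.
([IUTchII] Def 2.3 (i), kurims p.67) [claim: Mochizuki2012, status: disputed] -/
theorem EtaleThetaData.DoubleUnderline.relIndex_Huu_deltaTemp_inf_GtpXu :
    C.Huu.relIndex (D.DeltaTemp ⊓ D.GtpXu l) = l := by
  haveI := D.deltaTemp_normal
  haveI : (D.DeltaTemp ⊓ D.GtpXu l).Normal := inferInstance
  rw [← ThetaCovers.CoverData.relIndex_sup_eq_relIndex_of_normal C.Huu (D.DeltaTemp ⊓ D.GtpXu l),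
    C.Huu_sup_deltaTemp_inf_GtpXu]
  exact C.relIndex_Huu_GtpXu

/-- **`[Δ^tp_X : Δ^tp_{X̲̲_v}] = l²` at the [EtTh] model** ("extracting two copies of `ℤ/lℤ`", [EtTh] Rmk. 2.3.1), with
`Δ^tp_{X̲̲} := Δ^tp_X ∩ Π^tp_X̲̲`: `[Δ^tp_X : Δ^tp_{X̲}] · [Δ^tp_{X̲} : Δ^tp_{X̲̲}] = l · l`.  PROVED. [cite: MochizukiEtTh2009, Rmk 2.3.1 p.38] -/
theorem EtaleThetaData.DoubleUnderline.relIndex_Huu_deltaTemp : C.Huu.relIndex D.DeltaTemp = l ^ 2 := by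
  have h := Subgroup.relIndex_inf_mul_relIndex C.Huu (D.GtpXu l) D.DeltaTemp
  rw [inf_comm, C.relIndex_Huu_deltaTemp_inf_GtpXu, D.relIndex_GtpXu_deltaTemp l,
    inf_eq_left.mpr C.Huu_le_GtpXu] at h
  rw [← h, sq]

end ThetaSetting

end Literature.AnabelianGeometry.EtaleTheta

namespace Literature.IUT.HodgeArakelov

open Literature.AnabelianGeometry.EtaleTheta

variable {p : ℕ} [Fact p.Prime] {D : Literature.AnabelianGeometry.EtaleTheta.ThetaSetting p}
  {E : D.EtaleThetaData} {l : ℕ} (C : E.DoubleUnderline l) {N : ℕ+} (μ : D.CyclotomeMod l N)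
  (hC : D.Compat) (hS : D.Sec2Hyps) (hl : l.Prime) (hp2 : p ≠ 2) (hpl : p ≠ l)
  (hζ : ∃ ζ : D.K, IsPrimitiveRoot ζ (4 * l)) {η : (C.thetaEnvData μ hC hS).PiYdd → MuN p N}
  (hη : η ∈ (C.thetaEnvData μ hC hS).thetaCocycles)

/-- **Def. 2.3 (i) indices at the print-level model `BadPlaceSetting.ofUnderline`, both levels**: `[Π^tp_{X_v} : Π_v] = l`
(`ofUnderline_index_eq`) AND, on the geometric side, `[Δ^tp_{X_v} : Δ_v] = l`, stated over abc-iut-L2's subgroups of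
`Π^tp_X`: `[Δ^tp_X ∩ Π^tp_X̲ : Δ^tp_X ∩ Π^tp_X̲̲] = l`; and `[Δ^tp_X : Δ^tp_X ∩ Π^tp_X̲̲] = l²`.  PROVED.
([IUTchII] Def 2.3 (i), kurims p.67) [claim: Mochizuki2012, status: disputed] -/
theorem BadPlaceSetting.ofUnderline_indices :
    ((BadPlaceSetting.ofUnderline C μ hC hS hl hp2 hpl hζ hη).inclPlain.range).index = l ∧
      C.Huu.relIndex (D.DeltaTemp ⊓ D.GtpXu l) = l ∧ C.Huu.relIndex D.DeltaTemp = l ^ 2 :=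
  ⟨BadPlaceSetting.ofUnderline_index_eq C μ hC hS hl hp2 hpl hζ hη, C.relIndex_Huu_deltaTemp_inf_GtpXu,
    C.relIndex_Huu_deltaTemp⟩

end Literature.IUT.HodgeArakelov

end
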